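import Summits.AnomalousDissipation.AnomalousDissipation.Statement
import Literature.Analysis.FluidPDE.DoeringFoiasPowerProofs
import Literature.Analysis.FluidPDE.LerayHopfUniformEnergyMomentum
import HarnessLib

/-!
# The forcing-mode momentum balance and an unconditional energy floor (solo-informed)

The summit `AnomalousDissipation` (= `Literature.Turb.ZerothLaw`) asks for ONE smooth,
divergence-free, mean-zero steady force `f` on `T³` and a vanishing-viscosity family of global
Leray–Hopf solutions `u_j` with bounded mean energy `⟨‖u_j‖₂²⟩ ≤ E` and mean dissipation bounded
below.  `SoloInformedWitnessConstraints` / `…OnsagerSingularWitness` / `…OnsagerSlopeBound`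
record what the ENERGY inequality forces on a witness; this file records what the MOMENTUM
equation tested against the force itself forces on it — the lower-bound half of the
Doering–Foias (2002) analysis (`F ≤ c₁ νU/ℓ² + c₂ U²/ℓ`), so far absent from the tree.

For a global Leray–Hopf solution `u` (viscosity `ν`, steady smooth divergence-free force `f` on
`T^d`), testing the weak formulation with `Ψ = f`
(`Literature.Analysis.FluidPDE.Torus.IsLerayHopfOn.integral_inner_eq_add_setIntegral`) gives
`(u(t), f) - (u₀, f) = ∫₀ᵗ [ (u ⊗ u : ∇f) + ν (u, Δf) + ‖f‖₂² ] ds` with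
`(u ⊗ u : ∇f) = ∫ ⟪u, (u·∇)f⟫` (`lerayHopf_forceTest_identity`).  Consequences (sorry-free):

* `lerayHopf_timeMean_flux_eq`, `lerayHopf_timeMean_flux_tendsto_zero` — the **Reynolds-stress
  balance law**: the Cesàro means of `(u ⊗ u : ∇f) + ν(u, Δf) + ‖f‖₂²` equal
  `T⁻¹[(u(T), f) - (u₀, f)]` and tend to `0` (`ν > 0`, mean-zero `f`): the momentum injected in
  the forcing mode is carried off by the Reynolds stress against `∇f` plus an `O(ν)` viscous term.
* `lerayHopf_force_normSq_le_timeMean`, `lerayHopf_force_normSq_le_meanEnergy` — the **energy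
  floor** `‖f‖₂² ≤ G ⟨‖u‖₂²⟩ + ν ‖Δf‖₂ ⟨‖u‖₂²⟩^{1/2}` for any pointwise bound `∑ᵢ ‖∂ᵢ f‖ ≤ G`
  (honest `limsup` means; saturated by the laminar Kolmogorov flow).
* `force_normSq_le_of_vanishingViscosity`, `anomalousDissipation_imp_energyThreshold` — **no
  quiet families**: along ANY vanishing-viscosity Leray–Hopf family with one fixed force and
  `⟨‖u_j‖₂²⟩ ≤ E`, necessarily `‖f‖₂² ≤ G·E`; every zeroth-law witness has `E ≥ ‖f‖₂²/‖∇f‖_∞`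
  whatever its dissipation floor (compare the `ε`-dependent `⟨‖u_j‖₂²⟩ ≥ (ε/‖f‖₂)²` of
  `zerothLaw_witness_energy_floor`).

References: Doering–Foias, J. Fluid Mech. 467 (2002) 289–306, §2–§3 [DoeringFoias2002];
Cheskidov–Doering–Petrov, J. Math. Phys. 48 (2007) 065208, §III [CheskidovDoeringPetrov2006];
Temam, *Navier–Stokes Equations* (1984) Ch. III (1.22)–(1.25) (time-sliced weak formulation).
-/

noncomputable section

open MeasureTheory Filter Topology Set
open scoped ENNReal NNReal InnerProductSpace RealInnerProductSpace

namespace Summit.AnomalousDissipation.AnomalousDissipation.Theorems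

open Literature.Analysis.FunctionSpaces Literature.Analysis.FluidPDE

variable {d : Type*} [Fintype d] [DecidableEq d]

omit [Fintype d] [DecidableEq d] in
/-- If `c ≤ G·m(T) + a·√(m(T)) + T⁻¹·C` eventually (`G, a ≥ 0`, `m` eventually nonnegative and
bounded above) then `c ≤ G·ℓ + a·√ℓ`, `ℓ = limsup m` (`Monotone.map_limsup_of_continuousAt`).
[folklore] -/
theorem le_affineSqrt_limsup_of_eventually_le {m : ℝ → ℝ} {c G a C : ℝ} (hG : 0 ≤ G)
    (ha : 0 ≤ a) (hm0 : ∀ᶠ T in atTop, 0 ≤ m T) (hbdd : IsBoundedUnder (· ≤ ·) atTop m)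
    (h : ∀ᶠ T in atTop, c ≤ G * m T + a * Real.sqrt (m T) + T⁻¹ * C) :
    c ≤ G * limsup m atTop + a * Real.sqrt (limsup m atTop) := by
  have hcobdd : IsCoboundedUnder (· ≤ ·) atTop m := isCoboundedUnder_le_of_eventually_le atTop hm0
  have hφ_mono : Monotone fun y : ℝ => G * y + a * Real.sqrt y := fun x y hxy =>
    add_le_add (mul_le_mul_of_nonneg_left hxy hG)
      (mul_le_mul_of_nonneg_left (Real.sqrt_le_sqrt hxy) ha)
  have hφ_cont : Continuous fun y : ℝ => G * y + a * Real.sqrt y :=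
    (continuous_const.mul continuous_id).add (continuous_const.mul Real.continuous_sqrt)
  have h2 : limsup (fun T => G * m T + a * Real.sqrt (m T)) atTop
      = G * limsup m atTop + a * Real.sqrt (limsup m atTop) := by
    have h3 := hφ_mono.map_limsup_of_continuousAt m hφ_cont.continuousAt hbdd hcobdd
    simpa [Function.comp_def] using h3.symm
  obtain ⟨K, hK⟩ : ∃ K, ∀ᶠ T in atTop, m T ≤ K := hbdd
  have hbddφ : IsBoundedUnder (· ≤ ·) atTop (fun T => G * m T + a * Real.sqrt (m T)) :=
    isBoundedUnder_of_eventually_le (a := G * K + a * Real.sqrt K)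
      (hK.mono fun T hT => hφ_mono hT)
  rw [← h2]
  refine le_of_forall_pos_le_add fun δ hδ => ?_
  have hev : ∀ᶠ T in atTop, c - δ ≤ G * m T + a * Real.sqrt (m T) := by
    filter_upwards [h, eventually_gt_atTop 0, eventually_ge_atTop (|C| / δ)] with T hT hT0 hTδ
    have h1 : T⁻¹ * C ≤ δ := by
      rw [inv_mul_le_iff₀ hT0]
      exact (le_abs_self C).trans ((div_le_iff₀ hδ).1 hTδ)
    linarith
  have h1 : c - δ ≤ limsup (fun T => G * m T + a * Real.sqrt (m T)) atTop :=
    le_limsup_of_frequently_le hev.frequently hbddφ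
  linarith

section OneSolution

variable {ν : ℝ} {f u₀ : UnitAddTorus d → EuclideanSpace ℝ d}
  {u : ℝ → UnitAddTorus d → EuclideanSpace ℝ d}

/-- **Force-test identity**: testing the weak formulation with `Ψ = f` gives, for `t > 0`,
`(u(t), f) = (u₀, f) + ∫₀ᵗ [ (u ⊗ u : ∇f) + ν (u, Δf) + ‖f‖₂² ] ds` (Temam 1984 Ch. III
(1.22)–(1.25); Doering–Foias 2002 §2, momentum projected on the force).
[cite: DoeringFoias2002, §2] -/
theorem lerayHopf_forceTest_identity (hf : Torus.IsSmooth f) (hdiv : Torus.IsDivFree f)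
    (hu : Torus.IsGlobalLerayHopf ν (fun _ => f) u₀ u) {t : ℝ} (ht : 0 < t) :
    ∫ x, ⟪u t x, f x⟫ = (∫ x, ⟪u₀ x, f x⟫) + ∫ s in Ioc 0 t,
      ∫ x, (⟪u s x, Torus.convect (u s) f x⟫ + ν * ⟪u s x, Torus.laplacian f x⟫ + ⟪f x, f x⟫) :=
  (hu t ht).integral_inner_eq_add_setIntegral ht
    (aestronglyMeasurable_stLift_steady hf.continuous _)
    (lintegral_Ioo_lintegral_enorm_sq_steady_lt_top (hf.memLp 2) t) hf hdiv ⟨ht, le_rfl⟩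

/-- The flux integrand splits, at every time `s ≥ 0` (where `u(s) ∈ L²`), as
`(u ⊗ u : ∇f) + ν (u, Δf) + ‖f‖₂²`. [folklore] -/
theorem lerayHopf_fluxIntegral_split (hf : Torus.IsSmooth f)
    (hu : Torus.IsGlobalLerayHopf ν (fun _ => f) u₀ u) {s : ℝ} (hs : 0 ≤ s) :
    ∫ x, (⟪u s x, Torus.convect (u s) f x⟫ + ν * ⟪u s x, Torus.laplacian f x⟫ + ⟪f x, f x⟫) =
      (∫ x, ⟪u s x, Torus.convect (u s) f x⟫) + ν * (∫ x, ⟪u s x, Torus.laplacian f x⟫)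
        + ∫ x, ‖f x‖ ^ 2 := by
  have hmem : MemLp (u s) 2 volume := hu.memLp_two hs
  have i1 : Integrable (fun x => ⟪u s x, Torus.convect (u s) f x⟫) volume :=
    Torus.integrable_inner_convect_self hmem hf
  have i2 : Integrable (fun x => ⟪u s x, Torus.laplacian f x⟫) volume :=
    Torus.integrable_inner_of_continuous (hmem.integrable one_le_two) hf.laplacian.continuous
  have i3 : Integrable (fun x => ⟪f x, f x⟫) volume :=
    Torus.integrable_inner_of_continuous ((hf.memLp 2).integrable one_le_two) hf.continuous
  have i12 : Integrable (fun x => ⟪u s x, Torus.convect (u s) f x⟫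
      + ν * ⟪u s x, Torus.laplacian f x⟫) volume := i1.add (i2.const_mul ν)
  rw [integral_add i12 i3, integral_add i1 (i2.const_mul ν), integral_const_mul]
  congr 1
  exact integral_congr_ae (ae_of_all _ fun x => real_inner_self_eq_norm_sq (f x))

/-- Interval integrability of `s ↦ (u(s), a)` on `[0, T]` for a continuous field `a`. [folklore] -/
theorem lerayHopf_intervalIntegrable_inner (hu : Torus.IsGlobalLerayHopf ν (fun _ => f) u₀ u)
    {a : UnitAddTorus d → EuclideanSpace ℝ d} (ha : Continuous a) {T : ℝ} (hT : 0 < T) :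
    IntervalIntegrable (fun s => ∫ x, ⟪u s x, a x⟫) volume 0 T := by
  rw [intervalIntegrable_iff_integrableOn_Ioc_of_le hT.le]
  exact (integrableOn_Ioc_iff_integrableOn_Ioo).mpr ((hu T hT).integrableOn_integral_inner ha)

/-- Interval integrability of the flux `s ↦ (u ⊗ u : ∇f) + ν(u, Δf) + ‖f‖₂²`. [folklore] -/
theorem lerayHopf_intervalIntegrable_flux (hf : Torus.IsSmooth f)
    (hu : Torus.IsGlobalLerayHopf ν (fun _ => f) u₀ u) {T : ℝ} (hT : 0 < T) :
    IntervalIntegrable (fun s => ∫ x, (⟪u s x, Torus.convect (u s) f x⟫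
      + ν * ⟪u s x, Torus.laplacian f x⟫ + ⟪f x, f x⟫)) volume 0 T := by
  rw [intervalIntegrable_iff_integrableOn_Ioc_of_le hT.le]
  exact (integrableOn_Ioc_iff_integrableOn_Ioo).mpr ((hu T hT).integrableOn_flux
    (aestronglyMeasurable_stLift_steady hf.continuous _)
    (lintegral_Ioo_lintegral_enorm_sq_steady_lt_top (hf.memLp 2) T) hf)

/-- Interval integrability of the Reynolds-stress term `s ↦ (u ⊗ u : ∇f)`. [folklore] -/
theorem lerayHopf_intervalIntegrable_stress (hf : Torus.IsSmooth f)
    (hu : Torus.IsGlobalLerayHopf ν (fun _ => f) u₀ u) {T : ℝ} (hT : 0 < T) :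
    IntervalIntegrable (fun s => ∫ x, ⟪u s x, Torus.convect (u s) f x⟫) volume 0 T := by
  have hc : IntervalIntegrable (fun _ : ℝ => ∫ x, ‖f x‖ ^ 2) volume 0 T :=
    _root_.intervalIntegrable_const
  refine ((lerayHopf_intervalIntegrable_flux hf hu hT).sub
    (((lerayHopf_intervalIntegrable_inner hu hf.laplacian.continuous hT).const_mul ν).add
      hc)).congr fun s hs => ?_
  rw [uIoc_of_le hT.le] at hs
  show (∫ x, (⟪u s x, Torus.convect (u s) f x⟫ + ν * ⟪u s x, Torus.laplacian f x⟫ + ⟪f x, f x⟫))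
      - (ν * (∫ x, ⟪u s x, Torus.laplacian f x⟫) + ∫ x, ‖f x‖ ^ 2)
      = ∫ x, ⟪u s x, Torus.convect (u s) f x⟫
  rw [lerayHopf_fluxIntegral_split hf hu hs.1.le]
  ring

/-- **Cesàro form of the force-test identity**:
`T⁻¹∫₀ᵀ [ (u ⊗ u : ∇f) + ν (u, Δf) + ‖f‖₂² ] = T⁻¹ [(u(T), f) - (u₀, f)]`.
[cite: DoeringFoias2002, §2] -/
theorem lerayHopf_timeMean_flux_eq (hf : Torus.IsSmooth f) (hdiv : Torus.IsDivFree f)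
    (hu : Torus.IsGlobalLerayHopf ν (fun _ => f) u₀ u) {T : ℝ} (hT : 0 < T) :
    timeMean (fun s => ∫ x, (⟪u s x, Torus.convect (u s) f x⟫
      + ν * ⟪u s x, Torus.laplacian f x⟫ + ⟪f x, f x⟫)) T
      = T⁻¹ * ((∫ x, ⟪u T x, f x⟫) - ∫ x, ⟪u₀ x, f x⟫) := by
  have hid := lerayHopf_forceTest_identity hf hdiv hu hT
  unfold timeMean
  rw [intervalIntegral.integral_of_le hT.le]
  congr 1
  linarith

/-- `T⁻¹∫₀ᵀ flux = T⁻¹∫₀ᵀ (u ⊗ u : ∇f) + ν T⁻¹∫₀ᵀ (u, Δf) + ‖f‖₂²` for `T > 0`. [folklore] -/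
theorem lerayHopf_timeMean_flux_split (hf : Torus.IsSmooth f)
    (hu : Torus.IsGlobalLerayHopf ν (fun _ => f) u₀ u) {T : ℝ} (hT : 0 < T) :
    timeMean (fun s => ∫ x, (⟪u s x, Torus.convect (u s) f x⟫
      + ν * ⟪u s x, Torus.laplacian f x⟫ + ⟪f x, f x⟫)) T
      = timeMean (fun s => ∫ x, ⟪u s x, Torus.convect (u s) f x⟫) T
        + ν * timeMean (fun s => ∫ x, ⟪u s x, Torus.laplacian f x⟫) T + ∫ x, ‖f x‖ ^ 2 := by
  have hR := lerayHopf_intervalIntegrable_stress hf hu hT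
  have hL := lerayHopf_intervalIntegrable_inner hu hf.laplacian.continuous hT
  have hEq : EqOn (fun s => ∫ x, (⟪u s x, Torus.convect (u s) f x⟫
      + ν * ⟪u s x, Torus.laplacian f x⟫ + ⟪f x, f x⟫))
      (fun s => (∫ x, ⟪u s x, Torus.convect (u s) f x⟫)
        + ν * (∫ x, ⟪u s x, Torus.laplacian f x⟫) + ∫ x, ‖f x‖ ^ 2) (uIcc 0 T) := by
    intro s hs
    rw [uIcc_of_le hT.le] at hs
    exact lerayHopf_fluxIntegral_split hf hu hs.1
  unfold timeMean
  rw [intervalIntegral.integral_congr hEq,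
    intervalIntegral.integral_add (hR.add (hL.const_mul ν)) _root_.intervalIntegrable_const,
    intervalIntegral.integral_add hR (hL.const_mul ν), intervalIntegral.integral_const_mul,
    intervalIntegral.integral_const, sub_zero, smul_eq_mul]
  field_simp

/-- **The Reynolds-stress balance law** (Doering–Foias 2002 §2 at Leray–Hopf level, honest
Cesàro limits): for `ν > 0` and a mean-zero smooth divergence-free steady force the Cesàro means
of `(u ⊗ u : ∇f) + ν(u, Δf) + ‖f‖₂²` tend to `0` (the boundary term is bounded because the energy
is, `Torus.IsGlobalLerayHopf.exists_forall_integral_norm_sq_le_of_hasZeroMean`); for a Stokes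
eigen-force `-Δf = λf`: `⟨(u ⊗ u : ∇f)⟩_T - νλ⟨(u, f)⟩_T + ‖f‖₂² → 0`.
[cite: DoeringFoias2002, §2] -/
theorem lerayHopf_timeMean_flux_tendsto_zero (hν : 0 < ν) (hf : Torus.IsSmooth f)
    (hdiv : Torus.IsDivFree f) (hmean : Torus.HasZeroMean f)
    (hu : Torus.IsGlobalLerayHopf ν (fun _ => f) u₀ u) :
    Tendsto (fun T => timeMean (fun s => ∫ x, (⟪u s x, Torus.convect (u s) f x⟫
      + ν * ⟪u s x, Torus.laplacian f x⟫ + ⟪f x, f x⟫)) T) atTop (𝓝 0) := by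
  obtain ⟨R, hR⟩ := hu.exists_forall_integral_norm_sq_le_of_hasZeroMean hν (hf.memLp 2) hmean
  have hbdry : ∀ T, 0 < T → |(∫ x, ⟪u T x, f x⟫) - ∫ x, ⟪u₀ x, f x⟫| ≤
      Real.sqrt (max R 0) * Real.sqrt (∫ x, ‖f x‖ ^ 2) + |∫ x, ⟪u₀ x, f x⟫| := fun T hT => by
    have h1 : |∫ x, ⟪u T x, f x⟫| ≤ Real.sqrt (max R 0) * Real.sqrt (∫ x, ‖f x‖ ^ 2) :=
      (abs_integral_inner_le_sqrt_mul_sqrt (hu.memLp_two hT.le) (hf.memLp 2)).trans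
        (mul_le_mul_of_nonneg_right (Real.sqrt_le_sqrt ((hR T hT.le).trans (le_max_left _ _)))
          (Real.sqrt_nonneg _))
    exact (abs_sub _ _).trans (add_le_add h1 le_rfl)
  have hC : Tendsto (fun T : ℝ => T⁻¹ *
      (Real.sqrt (max R 0) * Real.sqrt (∫ x, ‖f x‖ ^ 2) + |∫ x, ⟪u₀ x, f x⟫|)) atTop (𝓝 0) := by
    simpa using tendsto_inv_atTop_zero.mul_const
      (Real.sqrt (max R 0) * Real.sqrt (∫ x, ‖f x‖ ^ 2) + |∫ x, ⟪u₀ x, f x⟫|)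
  refine squeeze_zero_norm' ?_ hC
  filter_upwards [eventually_gt_atTop 0] with T hT
  rw [lerayHopf_timeMean_flux_eq hf hdiv hu hT, Real.norm_eq_abs, abs_mul,
    abs_of_pos (inv_pos.2 hT)]
  exact mul_le_mul_of_nonneg_left (hbdry T hT) (inv_nonneg.2 hT.le)

/-- **Reynolds-stress bound**: `|T⁻¹∫₀ᵀ (u ⊗ u : ∇f)| ≤ G · T⁻¹∫₀ᵀ ‖u‖₂²` whenever
`∑ᵢ ‖∂ᵢ f‖ ≤ G` (`Torus.abs_integral_inner_convect_self_le`). [cite: DoeringFoias2002, §3] -/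
theorem lerayHopf_abs_timeMean_stress_le (hf : Torus.IsSmooth f)
    (hu : Torus.IsGlobalLerayHopf ν (fun _ => f) u₀ u) {G : ℝ}
    (hG : ∀ x, ∑ i, ‖Torus.partialDeriv i f x‖ ≤ G) {T : ℝ} (hT : 0 < T) :
    |timeMean (fun s => ∫ x, ⟪u s x, Torus.convect (u s) f x⟫) T| ≤
      G * timeMean (fun s => ∫ x, ‖u s x‖ ^ 2) T := by
  have hEint : IntervalIntegrable (fun s => ∫ x, ‖u s x‖ ^ 2) volume 0 T :=
    (intervalIntegrable_iff_integrableOn_Ioc_of_le hT.le).2 (hu.integrableOn_integral_norm_sq hT)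
  have hRint := lerayHopf_intervalIntegrable_stress hf hu hT
  have habs : |∫ s in (0 : ℝ)..T, ∫ x, ⟪u s x, Torus.convect (u s) f x⟫| ≤
      ∫ s in (0 : ℝ)..T, |∫ x, ⟪u s x, Torus.convect (u s) f x⟫| :=
    intervalIntegral.abs_integral_le_integral_abs hT.le
  have hmono : ∫ s in (0 : ℝ)..T, |∫ x, ⟪u s x, Torus.convect (u s) f x⟫| ≤
      ∫ s in (0 : ℝ)..T, G * ∫ x, ‖u s x‖ ^ 2 :=
    intervalIntegral.integral_mono_on hT.le hRint.abs (hEint.const_mul G) fun s hs =>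
      Torus.abs_integral_inner_convect_self_le (hu.memLp_two hs.1) hf hG
  rw [intervalIntegral.integral_const_mul] at hmono
  unfold timeMean
  rw [abs_mul, abs_of_pos (inv_pos.2 hT)]
  calc T⁻¹ * |∫ s in (0 : ℝ)..T, ∫ x, ⟪u s x, Torus.convect (u s) f x⟫|
      ≤ T⁻¹ * (G * ∫ s in (0 : ℝ)..T, ∫ x, ‖u s x‖ ^ 2) :=
        mul_le_mul_of_nonneg_left (habs.trans hmono) (inv_nonneg.2 hT.le)
    _ = G * (T⁻¹ * ∫ s in (0 : ℝ)..T, ∫ x, ‖u s x‖ ^ 2) := by ring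

/-- **Cauchy–Schwarz–Jensen bound** `|T⁻¹∫₀ᵀ (u, a)| ≤ ‖a‖₂ (T⁻¹∫₀ᵀ ‖u‖₂²)^{1/2}` for any
smooth `a` (the argument of `Torus.IsGlobalLerayHopf.abs_timeMean_power_le`).
[cite: CheskidovDoeringPetrov2006, eq. (17)] -/
theorem lerayHopf_abs_timeMean_inner_le (hu : Torus.IsGlobalLerayHopf ν (fun _ => f) u₀ u)
    {a : UnitAddTorus d → EuclideanSpace ℝ d} (ha : Torus.IsSmooth a) {T : ℝ} (hT : 0 < T) :
    |timeMean (fun s => ∫ x, ⟪u s x, a x⟫) T| ≤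
      Real.sqrt (∫ x, ‖a x‖ ^ 2) * Real.sqrt (timeMean (fun s => ∫ x, ‖u s x‖ ^ 2) T) := by
  set E : ℝ → ℝ := fun τ => ∫ x, ‖u τ x‖ ^ 2 with hEdef
  set P : ℝ → ℝ := fun τ => ∫ x, ⟪u τ x, a x⟫ with hPdef
  set A : ℝ := Real.sqrt (∫ x, ‖a x‖ ^ 2) with hA
  have hA0 : 0 ≤ A := Real.sqrt_nonneg _
  have hE0 : ∀ τ, 0 ≤ E τ := fun τ => integral_nonneg fun _ => sq_nonneg _
  have hEint : IntervalIntegrable E volume 0 T :=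
    (intervalIntegrable_iff_integrableOn_Ioc_of_le hT.le).2 (hu.integrableOn_integral_norm_sq hT)
  have hPint : IntervalIntegrable P volume 0 T :=
    lerayHopf_intervalIntegrable_inner hu ha.continuous hT
  refine le_mul_sqrt_of_forall_pos hA0 (timeMean_nonneg hE0 hT.le) fun b hb => ?_
  have hmono : ∫ τ in (0 : ℝ)..T, |P τ| ≤ ∫ τ in (0 : ℝ)..T, A * (E τ / (2 * b) + b / 2) := by
    refine intervalIntegral.integral_mono_on hT.le hPint.abs
      (((hEint.div_const _).add _root_.intervalIntegrable_const).const_mul A) fun τ hτ => ?_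
    have hcs : |P τ| ≤ A * Real.sqrt (E τ) := by
      rw [mul_comm]
      exact abs_integral_inner_le_sqrt_mul_sqrt (hu.memLp_two hτ.1) (ha.memLp 2)
    refine hcs.trans (mul_le_mul_of_nonneg_left ?_ hA0)
    have hsq : Real.sqrt (E τ) ^ 2 = E τ := Real.sq_sqrt (hE0 τ)
    have hid : E τ / (2 * b) + b / 2 = (Real.sqrt (E τ) ^ 2 + b ^ 2) / (2 * b) := by
      rw [hsq]
      field_simp
    rw [hid, le_div_iff₀ (by positivity)]
    nlinarith [sq_nonneg (Real.sqrt (E τ) - b)]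
  rw [intervalIntegral.integral_const_mul,
    intervalIntegral.integral_add (hEint.div_const _) _root_.intervalIntegrable_const,
    intervalIntegral.integral_div, intervalIntegral.integral_const, sub_zero, smul_eq_mul] at hmono
  have habs : |∫ τ in (0 : ℝ)..T, P τ| ≤ ∫ τ in (0 : ℝ)..T, |P τ| :=
    intervalIntegral.abs_integral_le_integral_abs hT.le
  unfold timeMean
  rw [abs_mul, abs_of_pos (inv_pos.2 hT)]
  calc T⁻¹ * |∫ τ in (0 : ℝ)..T, P τ|
      ≤ T⁻¹ * (A * ((∫ τ in (0 : ℝ)..T, E τ) / (2 * b) + T * (b / 2))) :=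
        mul_le_mul_of_nonneg_left (habs.trans hmono) (inv_nonneg.2 hT.le)
    _ = A * (T⁻¹ * (∫ τ in (0 : ℝ)..T, E τ) / (2 * b) + b / 2) := by
        field_simp

/-- **Finite-time energy floor**: for `ν ≥ 0`, `T > 0` and `∑ᵢ ‖∂ᵢ f‖ ≤ G`,
`‖f‖₂² ≤ G·m_T + ν ‖Δf‖₂ √m_T + T⁻¹ |(u(T), f) - (u₀, f)|`, `m_T = T⁻¹∫₀ᵀ ‖u‖₂²`
(Doering–Foias 2002 §3, the force-amplitude bound before averaging). [cite: DoeringFoias2002, §3] -/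
theorem lerayHopf_force_normSq_le_timeMean (hν : 0 ≤ ν) (hf : Torus.IsSmooth f)
    (hdiv : Torus.IsDivFree f) (hu : Torus.IsGlobalLerayHopf ν (fun _ => f) u₀ u) {G : ℝ}
    (hG : ∀ x, ∑ i, ‖Torus.partialDeriv i f x‖ ≤ G) {T : ℝ} (hT : 0 < T) :
    ∫ x, ‖f x‖ ^ 2 ≤ G * timeMean (fun s => ∫ x, ‖u s x‖ ^ 2) T
      + ν * Real.sqrt (∫ x, ‖Torus.laplacian f x‖ ^ 2)
          * Real.sqrt (timeMean (fun s => ∫ x, ‖u s x‖ ^ 2) T)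
      + T⁻¹ * |(∫ x, ⟪u T x, f x⟫) - ∫ x, ⟪u₀ x, f x⟫| := by
  have hsplit := lerayHopf_timeMean_flux_split hf hu hT
  have hflux := lerayHopf_timeMean_flux_eq hf hdiv hu hT
  have hR := lerayHopf_abs_timeMean_stress_le hf hu hG hT
  have hL := lerayHopf_abs_timeMean_inner_le hu hf.laplacian hT
  have h1 : -(timeMean (fun s => ∫ x, ⟪u s x, Torus.convect (u s) f x⟫) T)
      ≤ G * timeMean (fun s => ∫ x, ‖u s x‖ ^ 2) T := (neg_le_abs _).trans hR
  have h2 : -(ν * timeMean (fun s => ∫ x, ⟪u s x, Torus.laplacian f x⟫) T)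
      ≤ ν * Real.sqrt (∫ x, ‖Torus.laplacian f x‖ ^ 2)
          * Real.sqrt (timeMean (fun s => ∫ x, ‖u s x‖ ^ 2) T) := by
    rw [← mul_neg, mul_assoc]
    exact mul_le_mul_of_nonneg_left ((neg_le_abs _).trans hL) hν
  have h3 : T⁻¹ * ((∫ x, ⟪u T x, f x⟫) - ∫ x, ⟪u₀ x, f x⟫)
      ≤ T⁻¹ * |(∫ x, ⟪u T x, f x⟫) - ∫ x, ⟪u₀ x, f x⟫| :=
    mul_le_mul_of_nonneg_left (le_abs_self _) (inv_nonneg.2 hT.le)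
  linarith

/-- **Energy floor for one Leray–Hopf solution** (the lower-bound half of Doering–Foias 2002,
`F ≤ c₁ νU/ℓ² + c₂ U²/ℓ`, at Leray–Hopf level with honest `limsup` means): for `ν > 0` and a
steady smooth divergence-free mean-zero force with `∑ᵢ ‖∂ᵢ f‖ ≤ G`,
`‖f‖₂² ≤ G ⟨‖u‖₂²⟩ + ν ‖Δf‖₂ ⟨‖u‖₂²⟩^{1/2}`.  The laminar Kolmogorov flow `u = f/(νλ)`,
`-Δf = λ f`, saturates it (there the stress term vanishes). [cite: DoeringFoias2002, §3] -/
theorem lerayHopf_force_normSq_le_meanEnergy (hν : 0 < ν) (hf : Torus.IsSmooth f)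
    (hdiv : Torus.IsDivFree f) (hmean : Torus.HasZeroMean f)
    (hu : Torus.IsGlobalLerayHopf ν (fun _ => f) u₀ u) {G : ℝ}
    (hG : ∀ x, ∑ i, ‖Torus.partialDeriv i f x‖ ≤ G) :
    ∫ x, ‖f x‖ ^ 2 ≤ G * meanEnergy u
      + ν * Real.sqrt (∫ x, ‖Torus.laplacian f x‖ ^ 2) * Real.sqrt (meanEnergy u) := by
  have hG0 : 0 ≤ G := (Finset.sum_nonneg fun i _ => norm_nonneg _).trans (hG 0)
  obtain ⟨R, hR⟩ := hu.exists_forall_integral_norm_sq_le_of_hasZeroMean hν (hf.memLp 2) hmean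
  have hbdry : ∀ T, 0 < T → |(∫ x, ⟪u T x, f x⟫) - ∫ x, ⟪u₀ x, f x⟫| ≤
      Real.sqrt (max R 0) * Real.sqrt (∫ x, ‖f x‖ ^ 2) + |∫ x, ⟪u₀ x, f x⟫| := fun T hT => by
    have h1 : |∫ x, ⟪u T x, f x⟫| ≤ Real.sqrt (max R 0) * Real.sqrt (∫ x, ‖f x‖ ^ 2) :=
      (abs_integral_inner_le_sqrt_mul_sqrt (hu.memLp_two hT.le) (hf.memLp 2)).trans
        (mul_le_mul_of_nonneg_right (Real.sqrt_le_sqrt ((hR T hT.le).trans (le_max_left _ _)))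
          (Real.sqrt_nonneg _))
    exact (abs_sub _ _).trans (add_le_add h1 le_rfl)
  rw [show meanEnergy u = limsup (timeMean fun s => ∫ x, ‖u s x‖ ^ 2) atTop from rfl]
  refine le_affineSqrt_limsup_of_eventually_le
    (C := Real.sqrt (max R 0) * Real.sqrt (∫ x, ‖f x‖ ^ 2) + |∫ x, ⟪u₀ x, f x⟫|)
    hG0 (mul_nonneg hν.le (Real.sqrt_nonneg _)) ?_
    (hu.isBoundedUnder_timeMean_energy hν (hf.memLp 2) hmean) ?_
  · exact (eventually_ge_atTop 0).mono fun T hT =>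
      timeMean_nonneg (fun s => integral_nonneg fun _ => sq_nonneg _) hT
  · filter_upwards [eventually_gt_atTop 0] with T hT
    have h := lerayHopf_force_normSq_le_timeMean hν.le hf hdiv hu hG hT
    have hb := mul_le_mul_of_nonneg_left (hbdry T hT) (inv_nonneg.2 hT.le)
    linarith

end OneSolution

/-- **No quiet families.** Along any vanishing-viscosity family of global Leray–Hopf solutions
driven by ONE fixed steady smooth divergence-free mean-zero force `f` with `∑ᵢ ‖∂ᵢ f‖ ≤ G`, a
uniform mean-energy bound `⟨‖u_j‖₂²⟩ ≤ E` forces `‖f‖₂² ≤ G · E`: the energy of the family can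
never drop below `‖f‖₂²/‖∇f‖_∞`, independently of any dissipation floor.  In particular this
constrains every witness of `AnomalousDissipation` (whose data are exactly these hypotheses plus
a dissipation floor). [cite: DoeringFoias2002, §3] -/
theorem force_normSq_le_of_vanishingViscosity {f : UnitAddTorus d → EuclideanSpace ℝ d}
    (hf : Torus.IsSmooth f) (hdiv : Torus.IsDivFree f) (hmean : Torus.HasZeroMean f) {G : ℝ}
    (hG : ∀ x, ∑ i, ‖Torus.partialDeriv i f x‖ ≤ G) {ν : ℕ → ℝ}
    {u₀ : ℕ → UnitAddTorus d → EuclideanSpace ℝ d}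
    {u : ℕ → ℝ → UnitAddTorus d → EuclideanSpace ℝ d} (hν : ∀ j, 0 < ν j)
    (hν0 : Tendsto ν atTop (𝓝 0))
    (hLH : ∀ j, Torus.IsGlobalLerayHopf (ν j) (fun _ => f) (u₀ j) (u j)) {E : ℝ}
    (hE : ∀ j, meanEnergy (u j) ≤ E) :
    ∫ x, ‖f x‖ ^ 2 ≤ G * E := by
  have hG0 : 0 ≤ G := (Finset.sum_nonneg fun i _ => norm_nonneg _).trans (hG 0)
  have hE0 : 0 ≤ E := (meanEnergy_nonneg (u 0)).trans (hE 0)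
  refine le_of_forall_pos_le_add fun δ hδ => ?_
  have hlim : Tendsto (fun j => ν j * Real.sqrt (∫ x, ‖Torus.laplacian f x‖ ^ 2) * Real.sqrt E)
      atTop (𝓝 0) := by
    simpa using (hν0.mul_const (Real.sqrt (∫ x, ‖Torus.laplacian f x‖ ^ 2))).mul_const
      (Real.sqrt E)
  obtain ⟨j, hj⟩ := ((tendsto_order.1 hlim).2 δ hδ).exists
  have h := lerayHopf_force_normSq_le_meanEnergy (hν j) hf hdiv hmean (hLH j) hG
  have h1 : G * meanEnergy (u j) ≤ G * E := mul_le_mul_of_nonneg_left (hE j) hG0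
  have h2 : ν j * Real.sqrt (∫ x, ‖Torus.laplacian f x‖ ^ 2) * Real.sqrt (meanEnergy (u j))
      ≤ ν j * Real.sqrt (∫ x, ‖Torus.laplacian f x‖ ^ 2) * Real.sqrt E :=
    mul_le_mul_of_nonneg_left (Real.sqrt_le_sqrt (hE j))
      (mul_nonneg (hν j).le (Real.sqrt_nonneg _))
  linarith

/-- **Energy threshold for the zeroth law**: a witness `(f, ν_j, u_j, E)` of
`AnomalousDissipation` has `‖f‖₂² ≤ G·E` for every bound `∑ᵢ ‖∂ᵢ f‖ ≤ G` — the bounded-energy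
clause cannot be met below the threshold `‖f‖₂²/‖∇f‖_∞`. [cite: DoeringFoias2002, §3] -/
theorem anomalousDissipation_imp_energyThreshold (h : _root_.AnomalousDissipation) :
    ∃ (f : UnitAddTorus (Fin 3) → EuclideanSpace ℝ (Fin 3)) (ν : ℕ → ℝ)
      (u : ℕ → ℝ → UnitAddTorus (Fin 3) → EuclideanSpace ℝ (Fin 3)) (E : ℝ),
      Torus.IsSmooth f ∧ Torus.IsDivFree f ∧ Torus.HasZeroMean f ∧ (∀ j, 0 < ν j) ∧
        Tendsto ν atTop (𝓝 0) ∧ (∀ j, meanEnergy (u j) ≤ E) ∧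
        (∃ ε : ℝ, 0 < ε ∧ ∀ j, ε ≤ meanDissipation (ν j) (u j)) ∧
        ∀ G : ℝ, (∀ x, ∑ i, ‖Torus.partialDeriv i f x‖ ≤ G) → ∫ x, ‖f x‖ ^ 2 ≤ G * E := by
  obtain ⟨f, hf, hdiv, hmean, ν, u₀, u, hν, hν0, hLH, ⟨E, hE⟩, ε, hε, hεle⟩ := h
  exact ⟨f, ν, u, E, hf, hdiv, hmean, hν, hν0, hE, ⟨ε, hε, hεle⟩, fun G hG =>
    force_normSq_le_of_vanishingViscosity hf hdiv hmean hG hν hν0 hLH hE⟩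

end Summit.AnomalousDissipation.AnomalousDissipation.Theorems

end
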